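import Summits.QuantumFields.YangMills.Theorems.CovariantDischargeBrillouinMultiplierBessel
import HarnessLib

/-!
# Line «sandwich_discharge» on crux `HistoryTailL` (stmt-QuantumFields-19936), stub `stub_sandwichSweepGapCapped` (S′), brick B5 on `ℤ³` —
# (Z-d″) BESSEL FOR SECOND DIFFERENCES OF A LATTICE GREEN POTENTIAL (signed unit steps) AND THE EXACT-PROJECTION ROWS OF `da = ω − δ₃d₂β`:
# `∑_{x∈B} (∇_u∇_v (G₀ ∗ ω))(x)² ≤ ∑ ω²` (`≤ ¼∑ω²` mixed), `∑_{x∈B} (ω + ∇_c⁻∇_c⁺(G₀ ∗ ω))² ≤ ∑ω²`, `∑_B |da|² ≤ (3∕2)∑ω²` — every finite `B`, `d ≥ 3`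

Cell `ym3-torus` (YM ladder rung R3 = continuum SU(2) Yang–Mills on the three-torus — a RUNG, NOT the Clay problem: not d = 4, not
infinite volume, not a mass gap); WIDTH COPY «width 15» of ym3-torus-p1, gen 6; `--supports stmt-QuantumFields-19936` (helper).  THEOREMS ONLY
(0 `def`, default heartbeats), in the `ℤ^d` letters of lit ✓`LatticeGreenFunction` ∕ ✓`LatticeGreenPoisson` (`Site d = Fin d → ℤ` = `Zd d` of
✓`B4Eq19LatticeOperators`; `latticeGreen`, `brillouin`, `dispersion`, `SRW.phase`, `greenIntegrand`) over ✓p714853 (Z-d′)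
`…CovariantDischargeBrillouinMultiplierBessel` (abstract multiplier Bessel ★★`sum_sq_conv_le_of_multiplier_bound` + the signed-step multiplier
bounds). `d ≥ 3` GENERIC; the consumer takes `d = 3`.  THIS FILE IS THE IN-TREE INHABITANT of (Z-d′)'s abstract theorem.

WHY (w8-19936 g8's LOCATE-B5-Z3-COMMUTATOR 036a878b §5∕§6 + ADDENDUM cb2dbbcc §B, 19936 evidence #47∕#48; px8 g6 ARCH-S′ 9acc8a14 §3 B5).  After the
commutator truncation of the matched-charge potential `a = δ₂(G₀ ∗ ω)` (`G₀ = latticeGreen∕2`, `(−Δ)G₀ = δ₀` = ✓`latticeLaplacianZd_half_latticeGreen`),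
the sweep's quadratic cost (B1′∕B6: `Σ(d a_R)² ≤ A₂·L^j`, `A₂` UNIVERSAL, chosen before `j`) is a finite-box sum of squares of the components of
`da = ω − δ₃d₂β`, `β = G₀ ∗ ω`: for an `(ab)`-oriented charge these are `ω + ∇_c⁻∇_c⁺β` and `±∇_a⁻∇_c⁺β`, `±∇_b⁻∇_c⁺β` (`{a,b,c} = {1,2,3}`).  A pointwise
route loses `log²(L^j)`; by (Z-d′) with the multipliers `(e^{ip·u} − 1)(e^{ip·v} − 1)∕(2ε(p))` (`|·|² ≤ 1`, `≤ 1∕4` mixed) and `1 − (1 − cos p_c)∕ε(p) ∈ [0,1]`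
(diagonal, REAL):
  §2 ★★★`sum_sq_secondDiff_greenPotential_le`:  `∑_{x∈B} (β(x+u+v) − β(x+u) − β(x+v) + β(x))² ≤ ∑_{y∈S} ω(y)²`   (`u = ±e_a`, `v = ±e_b`, EVERY finite `B`),
     ★★`sum_sq_secondDiff_greenPotential_le_quarter`:  `… ≤ (∑ ω²)∕4`   (`a ≠ b`);
  §3 ★★`sum_sq_add_diagSecondDiff_greenPotential_le`:  `∑_{x∈B} (ω x + β(x+e_c) − 2β x + β(x−e_c))² ≤ ∑_{y∈S} ω(y)²`   (ω vanishing off `S`),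
     ★`sum_sq_bdiff_fdiff_greenPotential_le_quarter` (the mixed rows in `∇⁻∇⁺` letters), ★★`sum_sq_exactProjection_rows_le` (the three rows: `≤ (3∕2)·∑ω²`;
     the sharp global fact is `‖da‖ = ‖P_exact ω‖ ≤ ‖ω‖`).
§1 ★`secondDiff_half_latticeGreen_eq_integral` is the FOURIER REPRESENTATION `(G(z+u+v) − G(z+u) − G(z+v) + G(z))∕2 = (2π)^{−d}∫ Re(e^{ip·z} m(p)) dp` (any
`u v : ℤ^d`; four lit Green integrands ✓`integrableOn_greenIntegrand`), `ite_eq_zero_eq_integral` the Kronecker delta as `(2π)^{−d}∫Re(e^{ip·w})`.  The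
potential enters through `hβ : ∀ x, β x = ∑ y ∈ S, latticeGreen (x − y) ∕ 2 * ω y` (def-free; instantiate with `fun _ => rfl`).  RELATION TO THE LANE'S
FILES OF RECORD: ✓p714344 (Z-d) `…LatticeRieszL2.sum_sq_secondDiff_latticeGreen_conv_le` is the forward–forward case `u = e_a, v = e_b` with `G` for `G₀`
(constant `4 = 2²·1`); px8 g7's (Z-e) FILE 2 `…GreenPotentialL2.sum_sq_curl_potential_le` prices `∑_B|da|²` by `(2 + 18d²)∑ω²` over (Z-d) — this file is the
ALTERNATIVE supplier with constant `3∕2`, not a competing knit (both constants are universal, which is all B6 needs).  Text-independent of the stub and of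
(Z-a)(Z-b)(Z-c)(Z-e); restates no stub text.  HONEST SCOPE: Fourier bookkeeping on `ℤ^d`; NOTHING here proves B5, the capped stub, `HistoryTailL`, or any
summit statement; YM₃ on T³ is rung R3, not Clay. [folklore] (cf. Lawler, *Intersections of Random Walks* (1991) §1.5–1.6).
-/

noncomputable section

open MeasureTheory Finset

namespace Summit.QuantumFields.YangMills.Theorems.CovariantDischargeGreenSecondDifferenceBessel

open Literature.Probability.LatticeModels
open Summit.QuantumFields.YangMills.Theorems.CovariantDischargeBrillouinMultiplierBessel

variable {d : ℕ}

/-! ## §1 Fourier representation of the second difference of `G₀ = latticeGreen / 2` -/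

/-- The real part of the second-difference integrand is the second difference of the Green
integrand: `Re (e^{ip·z} (e^{ip·u} - 1)(e^{ip·v} - 1) / (2ε(p))) =
(h_{z+u+v}(p) - h_{z+u}(p) - h_{z+v}(p) + h_z(p)) / 2` with `h_w(p) = cos (p·w)/ε(p)`
(both sides are `0` at `ε(p) = 0` by the `x/0 = 0` convention). [folklore] -/
theorem re_secondDiff_integrand_eq (p : Fin d → ℝ) (u v z : Site d) :
    (Complex.exp (Complex.I * (SRW.phase p z : ℝ)) *
        ((Complex.exp (Complex.I * (SRW.phase p u : ℝ)) - 1) *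
          (Complex.exp (Complex.I * (SRW.phase p v : ℝ)) - 1) / ((2 * dispersion p : ℝ) : ℂ))).re =
      (greenIntegrand (z + u + v) p - greenIntegrand (z + u) p - greenIntegrand (z + v) p +
        greenIntegrand z p) / 2 := by
  have hexp : Complex.exp (Complex.I * (SRW.phase p z : ℝ)) *
      ((Complex.exp (Complex.I * (SRW.phase p u : ℝ)) - 1) *
        (Complex.exp (Complex.I * (SRW.phase p v : ℝ)) - 1)) =
      Complex.exp (Complex.I * (SRW.phase p (z + u + v) : ℝ)) -
        Complex.exp (Complex.I * (SRW.phase p (z + u) : ℝ)) -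
        Complex.exp (Complex.I * (SRW.phase p (z + v) : ℝ)) +
        Complex.exp (Complex.I * (SRW.phase p z : ℝ)) := by
    rw [cexp_phase_add p (z + u) v, cexp_phase_add p z u, cexp_phase_add p z v]; ring
  rw [mul_div_assoc', hexp, Complex.div_ofReal_re]
  simp only [Complex.add_re, Complex.sub_re, re_cexp_I_mul]
  unfold greenIntegrand SRW.phase
  ring

variable (d) in
/-- The second-difference integrand `p ↦ Re (e^{ip·z} m(p))` is integrable on the Brillouin zone
(`d ≥ 3`; it is a combination of four Green integrands). [folklore] -/
theorem integrableOn_re_secondDiff_integrand (hd : 3 ≤ d) (u v z : Site d) :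
    IntegrableOn (fun p : Fin d → ℝ =>
      (Complex.exp (Complex.I * (SRW.phase p z : ℝ)) *
        ((Complex.exp (Complex.I * (SRW.phase p u : ℝ)) - 1) *
          (Complex.exp (Complex.I * (SRW.phase p v : ℝ)) - 1) / ((2 * dispersion p : ℝ) : ℂ))).re)
      (brillouin d) := by
  have h : (fun p : Fin d → ℝ =>
      (Complex.exp (Complex.I * (SRW.phase p z : ℝ)) *
        ((Complex.exp (Complex.I * (SRW.phase p u : ℝ)) - 1) *
          (Complex.exp (Complex.I * (SRW.phase p v : ℝ)) - 1) / ((2 * dispersion p : ℝ) : ℂ))).re) =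
      fun p => (greenIntegrand (z + u + v) p - greenIntegrand (z + u) p - greenIntegrand (z + v) p +
        greenIntegrand z p) / 2 := funext fun p => re_secondDiff_integrand_eq p u v z
  rw [h]
  exact ((((integrableOn_greenIntegrand d hd (z + u + v)).sub
    (integrableOn_greenIntegrand d hd (z + u))).sub (integrableOn_greenIntegrand d hd (z + v))).add
    (integrableOn_greenIntegrand d hd z)).div_const 2

variable (d) in
/-- **Fourier representation of the second difference of `G₀ = latticeGreen/2`** (`d ≥ 3`):
`(G(z+u+v) - G(z+u) - G(z+v) + G(z))/2 = (2π)^{-d} ∫_{[-π,π]^d} Re (e^{ip·z} m(p)) dp`,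
`m(p) = (e^{ip·u} - 1)(e^{ip·v} - 1)/(2ε(p))`. [folklore] -/
theorem secondDiff_half_latticeGreen_eq_integral (hd : 3 ≤ d) (u v z : Site d) :
    (latticeGreen (z + u + v) - latticeGreen (z + u) - latticeGreen (z + v) + latticeGreen z) / 2 =
      (∫ p in brillouin d,
        (Complex.exp (Complex.I * (SRW.phase p z : ℝ)) *
          ((Complex.exp (Complex.I * (SRW.phase p u : ℝ)) - 1) *
            (Complex.exp (Complex.I * (SRW.phase p v : ℝ)) - 1) / ((2 * dispersion p : ℝ) : ℂ))).re) /
        (2 * Real.pi) ^ d := by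
  simp_rw [re_secondDiff_integrand_eq, latticeGreen_eq]
  rw [integral_div, integral_add, integral_sub, integral_sub]
  · ring
  · exact integrableOn_greenIntegrand d hd _
  · exact integrableOn_greenIntegrand d hd _
  · exact (integrableOn_greenIntegrand d hd _).sub (integrableOn_greenIntegrand d hd _)
  · exact integrableOn_greenIntegrand d hd _
  · exact ((integrableOn_greenIntegrand d hd _).sub (integrableOn_greenIntegrand d hd _)).sub
      (integrableOn_greenIntegrand d hd _)
  · exact integrableOn_greenIntegrand d hd _

/-! ## §2 The Green potential: Bessel bounds for its second differences -/

/-- The second difference of the Green potential `β = G₀ ∗ ω` is the convolution of `ω` with the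
second difference of `G₀ = latticeGreen/2`. [folklore] -/
theorem secondDiff_greenPotential_eq_conv (u v : Site d) (S : Finset (Site d)) (ω : Site d → ℝ)
    {β : Site d → ℝ} (hβ : ∀ x, β x = ∑ y ∈ S, latticeGreen (x - y) / 2 * ω y) (x : Site d) :
    β (x + u + v) - β (x + u) - β (x + v) + β x = ∑ y ∈ S,
      (latticeGreen (x - y + u + v) - latticeGreen (x - y + u) - latticeGreen (x - y + v) +
        latticeGreen (x - y)) / 2 * ω y := by
  simp only [hβ, ← Finset.sum_sub_distrib, ← Finset.sum_add_distrib]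
  refine Finset.sum_congr rfl fun y _ => ?_
  rw [show x + u + v - y = x - y + u + v by abel, show x + u - y = x - y + u by abel,
    show x + v - y = x - y + v by abel]
  ring

variable (d) in
/-- ★★★ **BESSEL BOUND FOR SECOND DIFFERENCES OF A LATTICE GREEN POTENTIAL** (`d ≥ 3`, any pair of
signed unit coordinate steps `u = ±e_a`, `v = ±e_b`, `a = b` allowed). For every finitely supported
real charge `ω` on `ℤ^d` (carrier `S`), its Green potential
`β(x) = ∑_{y∈S} (latticeGreen (x-y)/2) ω(y)` (`latticeGreen/2` = the Green function of `-Δ_{ℤ^d}`,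
lit `latticeLaplacianZd_half_latticeGreen`) satisfies, on EVERY finite `B ⊆ ℤ^d`,
`∑_{x∈B} (β(x+u+v) - β(x+u) - β(x+v) + β(x))² ≤ ∑_{y∈S} ω(y)²`
— Plancherel/Bessel on the Brillouin zone with the multiplier bound
`|(e^{ip·u}-1)(e^{ip·v}-1)/(2ε(p))|² = (1-cos p_a)(1-cos p_b)/ε(p)² ≤ 1`. The constant is uniform
in `B`, `S`, `u`, `v` and `d`. [folklore] -/
theorem sum_sq_secondDiff_greenPotential_le (hd : 3 ≤ d) {a b : Fin d} {u v : Site d}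
    (hu : u = Pi.single a 1 ∨ u = -Pi.single a 1) (hv : v = Pi.single b 1 ∨ v = -Pi.single b 1)
    (S : Finset (Site d)) (ω : Site d → ℝ) {β : Site d → ℝ}
    (hβ : ∀ x, β x = ∑ y ∈ S, latticeGreen (x - y) / 2 * ω y) (B : Finset (Site d)) :
    ∑ x ∈ B, (β (x + u + v) - β (x + u) - β (x + v) + β x) ^ 2 ≤ ∑ y ∈ S, ω y ^ 2 := by
  have h := sum_sq_conv_le_of_multiplier_bound
    (K := fun w => (latticeGreen (w + u + v) - latticeGreen (w + u) - latticeGreen (w + v) +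
      latticeGreen w) / 2)
    (fun w => secondDiff_half_latticeGreen_eq_integral d hd u v w)
    (fun w => integrableOn_re_secondDiff_integrand d hd u v w)
    (fun p _ => norm_sq_multiplier_le_one p hu hv) S ω B
  simp only [← secondDiff_greenPotential_eq_conv u v S ω hβ, one_mul] at h
  exact h

variable (d) in
/-- ★★ **BESSEL BOUND, MIXED DIRECTIONS** (`d ≥ 3`, `a ≠ b`, `u = ±e_a`, `v = ±e_b`): the sharper
constant `1/4` from the AM–GM multiplier bound `(1-cos p_a)(1-cos p_b) ≤ ε(p)²/4`:
`∑_{x∈B} (β(x+u+v) - β(x+u) - β(x+v) + β(x))² ≤ (∑_{y∈S} ω(y)²)/4`. [folklore] -/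
theorem sum_sq_secondDiff_greenPotential_le_quarter (hd : 3 ≤ d) {a b : Fin d} (hab : a ≠ b)
    {u v : Site d}
    (hu : u = Pi.single a 1 ∨ u = -Pi.single a 1) (hv : v = Pi.single b 1 ∨ v = -Pi.single b 1)
    (S : Finset (Site d)) (ω : Site d → ℝ) {β : Site d → ℝ}
    (hβ : ∀ x, β x = ∑ y ∈ S, latticeGreen (x - y) / 2 * ω y) (B : Finset (Site d)) :
    ∑ x ∈ B, (β (x + u + v) - β (x + u) - β (x + v) + β x) ^ 2 ≤ (∑ y ∈ S, ω y ^ 2) / 4 := by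
  have h := sum_sq_conv_le_of_multiplier_bound
    (K := fun w => (latticeGreen (w + u + v) - latticeGreen (w + u) - latticeGreen (w + v) +
      latticeGreen w) / 2)
    (fun w => secondDiff_half_latticeGreen_eq_integral d hd u v w)
    (fun w => integrableOn_re_secondDiff_integrand d hd u v w)
    (fun p _ => norm_sq_multiplier_le_quarter p hab hu hv) S ω B
  simp only [← secondDiff_greenPotential_eq_conv u v S ω hβ] at h
  linarith

/-! ## §3 The components of the exact projection `da = ω − δ₃d₂β`: diagonal row with constant `1`,
mixed rows with constant `1/4` -/

/-- The Kronecker delta on `ℤ^d` as a Brillouin integral: `[w = 0] = (2π)^{-d}∫ Re (e^{ip·w} · 1) dp`.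
[folklore] -/
theorem ite_eq_zero_eq_integral (w : Site d) :
    (if w = 0 then (1 : ℝ) else 0) =
      (∫ p in brillouin d, (Complex.exp (Complex.I * (SRW.phase p w : ℝ)) * 1).re) /
        (2 * Real.pi) ^ d := by
  have hπ : (2 * Real.pi) ^ d ≠ 0 := by positivity
  simp_rw [mul_one, re_cexp_I_mul]
  unfold SRW.phase
  rw [integral_brillouin_cos_sum_mul w]
  split_ifs <;> simp [hπ]

/-- The diagonal second-difference multiplier is REAL and lies in `[0, 1]`:
`(e^{-ip_c} - 1)(e^{ip_c} - 1)/(2ε(p)) = (1 - cos p_c)/ε(p)`. [folklore] -/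
theorem diag_multiplier_eq (p : Fin d → ℝ) (c : Fin d) :
    (Complex.exp (Complex.I * (SRW.phase p (-Pi.single c 1) : ℝ)) - 1) *
        (Complex.exp (Complex.I * (SRW.phase p (Pi.single c 1) : ℝ)) - 1) /
          ((2 * dispersion p : ℝ) : ℂ) =
      (((1 - Real.cos (p c)) / dispersion p : ℝ) : ℂ) := by
  have h1 : SRW.phase p (Pi.single c 1) = p c := sum_mul_intCast_single_one p c
  have h2 : SRW.phase p (-Pi.single c 1) = -p c := by
    rw [← h1]; unfold SRW.phase
    simp only [Pi.neg_apply, Int.cast_neg, mul_neg, Finset.sum_neg_distrib]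
  rw [h1, h2]
  have hprod : (Complex.exp (Complex.I * ((-p c : ℝ) : ℂ)) - 1) *
      (Complex.exp (Complex.I * ((p c : ℝ) : ℂ)) - 1) = ((2 * (1 - Real.cos (p c)) : ℝ) : ℂ) := by
    have hmul : Complex.exp (Complex.I * ((-p c : ℝ) : ℂ)) * Complex.exp (Complex.I * ((p c : ℝ) : ℂ)) = 1 := by
      rw [← Complex.exp_add]; push_cast; ring_nf; exact Complex.exp_zero
    apply Complex.ext
    · simp only [sub_mul, mul_sub, hmul, one_mul, mul_one, Complex.sub_re, Complex.one_re,
        Complex.ofReal_re, re_cexp_I_mul, Real.cos_neg]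
      ring
    · simp only [sub_mul, mul_sub, hmul, one_mul, mul_one, Complex.sub_im, Complex.one_im,
        Complex.ofReal_im, im_cexp_I_mul]
      rw [Real.sin_neg]; ring
  rw [hprod]
  rcases eq_or_ne (dispersion p) 0 with h0 | h0
  · rw [h0]; simp
  · push_cast
    field_simp

/-- The multiplier of the diagonal component `ω + ∇_c⁻∇_c⁺β` of the exact projection,
`1 - (1 - cos p_c)/ε(p) = (∑_{i ≠ c}(1 - cos p_i))/ε(p)`, has modulus at most `1`. [folklore] -/
theorem norm_sq_one_sub_diag_multiplier_le_one (p : Fin d → ℝ) (c : Fin d) :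
    ‖1 - (Complex.exp (Complex.I * (SRW.phase p (-Pi.single c 1) : ℝ)) - 1) *
        (Complex.exp (Complex.I * (SRW.phase p (Pi.single c 1) : ℝ)) - 1) /
          ((2 * dispersion p : ℝ) : ℂ)‖ ^ 2 ≤ 1 := by
  rw [diag_multiplier_eq, ← Complex.ofReal_one, ← Complex.ofReal_sub, Complex.norm_real,
    Real.norm_eq_abs, sq_abs]
  have hc := one_sub_cos_le_dispersion p c
  have hc0 : 0 ≤ 1 - Real.cos (p c) := sub_nonneg.2 (Real.cos_le_one _)
  rcases eq_or_lt_of_le (dispersion_nonneg p) with h0 | hpos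
  · rw [← h0]; norm_num
  · have hle : (1 - Real.cos (p c)) / dispersion p ≤ 1 := (div_le_one hpos).2 hc
    have hge : 0 ≤ (1 - Real.cos (p c)) / dispersion p := div_nonneg hc0 hpos.le
    nlinarith

variable (d) in
/-- ★★ **THE DIAGONAL ROW OF THE EXACT PROJECTION** (`d ≥ 3`): for a real charge `ω` VANISHING
OFF its finite carrier `S`, its Green potential `β = G₀ ∗ ω` and any coordinate `c`, on EVERY
finite `B ⊆ ℤ^d`:
`∑_{x∈B} (ω(x) + β(x+e_c) - 2β(x) + β(x-e_c))² ≤ ∑_{y∈S} ω(y)²`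
— the kernel `δ₀ + ∇_c⁻∇_c⁺G₀` has the REAL multiplier `1 - (1-cos p_c)/ε(p) ∈ [0,1]`; this is the
`(μν)`-component `ω_{μν} + ∇_c⁻∇_c⁺β_{μν}` (`c ∉ {μ,ν}`) of `da = ω - δ₃d₂β` with constant `1`
(not `2 + 2`). [folklore] -/
theorem sum_sq_add_diagSecondDiff_greenPotential_le (hd : 3 ≤ d) (c : Fin d)
    (S : Finset (Site d)) (ω : Site d → ℝ) (hωS : ∀ x, x ∉ S → ω x = 0) {β : Site d → ℝ}
    (hβ : ∀ x, β x = ∑ y ∈ S, latticeGreen (x - y) / 2 * ω y) (B : Finset (Site d)) :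
    ∑ x ∈ B, (ω x + (β (x + Pi.single c 1) - 2 * β x + β (x - Pi.single c 1))) ^ 2 ≤
      ∑ y ∈ S, ω y ^ 2 := by
  set e : Site d := Pi.single c 1 with he
  -- the kernel `K = δ₀ - D_{-e,e} G₀` and its multiplier `1 - μ`
  have h := sum_sq_conv_le_of_multiplier_bound
    (K := fun w => (if w = 0 then (1 : ℝ) else 0) -
      (latticeGreen (w + -e + e) - latticeGreen (w + -e) - latticeGreen (w + e) +
        latticeGreen w) / 2)
    (m := fun p => 1 - (Complex.exp (Complex.I * (SRW.phase p (-e) : ℝ)) - 1) *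
      (Complex.exp (Complex.I * (SRW.phase p e : ℝ)) - 1) / ((2 * dispersion p : ℝ) : ℂ))
    (fun w => by
      rw [ite_eq_zero_eq_integral, secondDiff_half_latticeGreen_eq_integral d hd (-e) e w,
        ← sub_div, ← integral_sub]
      · congr 1
        refine setIntegral_congr_fun (measurableSet_brillouin d) fun p _ => ?_
        rw [← Complex.sub_re, ← mul_sub]
      · exact ((by unfold SRW.phase; fun_prop : Continuous fun p : Fin d → ℝ =>
          (Complex.exp (Complex.I * (SRW.phase p w : ℝ)) * 1).re)).continuousOn.integrableOn_compact
          (isCompact_brillouin d)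
      · exact integrableOn_re_secondDiff_integrand d hd (-e) e w)
    (fun w => by
      have h1 : IntegrableOn (fun p : Fin d → ℝ =>
          (Complex.exp (Complex.I * (SRW.phase p w : ℝ)) * 1).re) (brillouin d) :=
        (by unfold SRW.phase; fun_prop : Continuous fun p : Fin d → ℝ =>
          (Complex.exp (Complex.I * (SRW.phase p w : ℝ)) * 1).re).continuousOn.integrableOn_compact
          (isCompact_brillouin d)
      refine ((h1.sub (integrableOn_re_secondDiff_integrand d hd (-e) e w)).congr_fun
        (fun p _ => ?_) (measurableSet_brillouin d))
      simp only [Pi.sub_apply, ← Complex.sub_re, ← mul_sub])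
    (fun p _ => norm_sq_one_sub_diag_multiplier_le_one p c) S ω B
  -- identify `K ∗ ω` with `ω + ∇_c⁻∇_c⁺β`
  have hrow : ∀ x, ∑ y ∈ S, ((if x - y = 0 then (1 : ℝ) else 0) -
      (latticeGreen (x - y + -e + e) - latticeGreen (x - y + -e) - latticeGreen (x - y + e) +
        latticeGreen (x - y)) / 2) * ω y =
      ω x + (β (x + e) - 2 * β x + β (x - e)) := by
    intro x
    simp only [sub_mul, Finset.sum_sub_distrib, ← secondDiff_greenPotential_eq_conv (-e) e S ω hβ]
    have hδ : ∑ y ∈ S, (if x - y = 0 then (1 : ℝ) else 0) * ω y = ω x := by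
      simp_rw [sub_eq_zero, ite_mul, one_mul, zero_mul]
      rw [Finset.sum_ite_eq]
      split_ifs with hx
      · rfl
      · exact (hωS x hx).symm
    rw [hδ, show x + -e + e = x by abel, show x + -e = x - e by abel]
    ring
  simp only [hrow, one_mul] at h
  exact h

variable (d) in
/-- ★ **THE MIXED ROWS IN `∇⁻∇⁺` LETTERS** (`d ≥ 3`, `a ≠ c`):
`∑_{x∈B} ((β(x+e_c) - β(x)) - (β(x-e_a+e_c) - β(x-e_a)))² ≤ (∑_{y∈S} ω(y)²)/4` — the
`(μν)`-components `±∇_a⁻∇_c⁺β` of `da = ω - δ₃d₂β`; `sum_sq_secondDiff_greenPotential_le_quarter`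
at `u := -e_a`, `v := e_c`. [folklore] -/
theorem sum_sq_bdiff_fdiff_greenPotential_le_quarter (hd : 3 ≤ d) {a c : Fin d} (hac : a ≠ c)
    (S : Finset (Site d)) (ω : Site d → ℝ) {β : Site d → ℝ}
    (hβ : ∀ x, β x = ∑ y ∈ S, latticeGreen (x - y) / 2 * ω y) (B : Finset (Site d)) :
    ∑ x ∈ B, ((β (x + Pi.single c 1) - β x) -
        (β (x - Pi.single a 1 + Pi.single c 1) - β (x - Pi.single a 1))) ^ 2 ≤
      (∑ y ∈ S, ω y ^ 2) / 4 := by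
  have h := sum_sq_secondDiff_greenPotential_le_quarter d hd hac (u := -Pi.single a 1)
    (v := Pi.single c 1) (Or.inr rfl) (Or.inl rfl) S ω hβ B
  refine le_trans (le_of_eq (Finset.sum_congr rfl fun x _ => ?_)) h
  rw [show x + -Pi.single a 1 + Pi.single c 1 = x - Pi.single a 1 + Pi.single c 1 by abel,
    show x + -Pi.single a 1 = x - Pi.single a 1 by abel]
  ring

variable (d) in
/-- ★★ **THE THREE ROWS TOGETHER** (`d ≥ 3`; `a`, `b` both `≠ c`): for a real charge `ω` vanishing
off `S`, `β = G₀ ∗ ω`, on EVERY finite `B`: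
`∑_{x∈B} [(ω + ∇_c⁻∇_c⁺β)² + (∇_a⁻∇_c⁺β)² + (∇_b⁻∇_c⁺β)²](x) ≤ (3/2)·∑_{y∈S} ω(y)²` — in `d = 3`
with `{a,b,c} = {1,2,3}` the left side is `∑_{x∈B} |da(x)|²` for `a = δ₂(G₀ ∗ ω)` of a
`(ab)`-oriented charge (w8 LOCATE §5; the sharp global statement is `‖da‖ ≤ ‖ω‖`). [folklore] -/
theorem sum_sq_exactProjection_rows_le (hd : 3 ≤ d) {a b c : Fin d} (hac : a ≠ c) (hbc : b ≠ c)
    (S : Finset (Site d)) (ω : Site d → ℝ) (hωS : ∀ x, x ∉ S → ω x = 0) {β : Site d → ℝ}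
    (hβ : ∀ x, β x = ∑ y ∈ S, latticeGreen (x - y) / 2 * ω y) (B : Finset (Site d)) :
    ∑ x ∈ B, ((ω x + (β (x + Pi.single c 1) - 2 * β x + β (x - Pi.single c 1))) ^ 2 +
      ((β (x + Pi.single c 1) - β x) -
        (β (x - Pi.single a 1 + Pi.single c 1) - β (x - Pi.single a 1))) ^ 2 +
      ((β (x + Pi.single c 1) - β x) -
        (β (x - Pi.single b 1 + Pi.single c 1) - β (x - Pi.single b 1))) ^ 2) ≤
      3 / 2 * ∑ y ∈ S, ω y ^ 2 := by
  rw [Finset.sum_add_distrib, Finset.sum_add_distrib]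
  have h1 := sum_sq_add_diagSecondDiff_greenPotential_le d hd c S ω hωS hβ B
  have h2 := sum_sq_bdiff_fdiff_greenPotential_le_quarter d hd hac S ω hβ B
  have h3 := sum_sq_bdiff_fdiff_greenPotential_le_quarter d hd hbc S ω hβ B
  linarith

end Summit.QuantumFields.YangMills.Theorems.CovariantDischargeGreenSecondDifferenceBessel

end
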